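import Summits.Ventures.QEC.Census.RefinedIPCertificateGridFast
import HarnessLib

/-!
# Refined certificates on the evaluation grid: the plain point table by MOMENTS (Krawtchouk rows, streamed tables)

Venture QEC (cell `qec`, LADDER-QEC rung X1; row 06). The grid leaf checks (`RefinedIPCertificateGrid*.lean`,
`RefinedPairCertificate.lean`) read, for every refined class, the point sums `Σ_p μ_p · mono(p; a,b,c)` of CRSS's refined
MacWilliams identity [CalderbankEtAl1998, §7 (ii)] off the tables `gridTab` — `#x-nodes × (w₀+1)² × #y-nodes` products of
multi-hundred-bit integers; at `(n, w₀) = (27, 24)` (the cell `(27,15)` of [LaiAshikhmin2018, §5.2]) this is ≈ `3·10⁶`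
products and the kernel runs out of memory (measured, 2026-08-27). This file computes the SAME plain table differently:
on the canonical y-grid `(1, j, l)` the monomial separates, `yPart((1,j,l); r, s) = j^r · l^s`, so the point sum of one
x-node is a product of two small matrices with the multiplier chunk-matrix — the MOMENT table `M(j,s) = Σ_l μ(j,l) l^s`
and `I(r,s) = Σ_j j^r M(j,s)` (`mtab`, `itab`, `ptab`; all streamed with `zipWith`, no indexing) — and PROVES entry-wise
equality with `gridTab` inside the box (`get3_ptab`). It also provides the one-dimensional (generalised) Krawtchouk rows
`krRow γ δ p q` (coefficients of `(1+γz)^p(1+δz)^q`) with their expansion identity `hev_krRow`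
[MacWilliamsSloane1977, Ch. 5 §7 eq. (54)], used by `RefinedGridTransform.lean` for the transformed table. HONEST FRAMING: a
re-implementation of pure functions with equality proofs; nothing here certifies a distance.
[cite: CalderbankEtAl1998, §7 (ii) (printed p. 28)]; [cite: MacWilliamsSloane1977, Ch. 5 §7 eq. (54) and Ch. 17 §4 Thm. 20].
-/

namespace Summit.Ventures.QEC.Census

open Finset Literature.InformationTheory.QuantumCodes

/-! ### 1. One-dimensional Krawtchouk rows -/

/-- One step of `L(z) · (1 + γ z)`: the running previous coefficient `p` is folded in. Column: definition (ours). [folklore] -/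
def lmAux (γ : ℤ) : ℤ → List ℤ → List ℤ
  | p, [] => [γ * p]
  | p, a :: t => (a + γ * p) :: lmAux γ a t

/-- Coefficient list (low degree first) of `L(z) · (1 + γ z)`. Column: definition (ours). [folklore] -/
def linMul (γ : ℤ) (L : List ℤ) : List ℤ := lmAux γ 0 L

/-- The (generalised) Krawtchouk row: the coefficient list of `(1 + γ z)^p (1 + δ z)^q`, i.e. the numbers `K_s` with
`(u + γ v)^p (u + δ v)^q = Σ_s K_s u^{p+q−s} v^s` (`γ = 1, δ = −1`: the binary Krawtchouk coefficients). Column: definition (ours).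
[cite: MacWilliamsSloane1977, Ch. 5 §2 eq. (15) and §7 eq. (54) (generating function `(1+γz)^{n−x}(1−z)^x = Σ_k P_k(x) z^k`)] -/
def krRow (γ δ : ℤ) (p q : ℕ) : List ℤ := (linMul δ)^[q] ((linMul γ)^[p] [1])

/-- Homogeneous evaluation `Σ_i L_i u^{deg−i} v^i` (`deg = |L| − 1`), by recursion. Column: definition (ours). [folklore] -/
def hev (u v : ℤ) : List ℤ → ℤ
  | [] => 0
  | a :: t => a * u ^ t.length + v * hev u v t

/-- `lmAux` adds one coefficient. [folklore] -/
theorem length_lmAux (γ p : ℤ) (t : List ℤ) : (lmAux γ p t).length = t.length + 1 := by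
  induction t generalizing p with
  | nil => rfl
  | cons a t ih => simp [lmAux, ih]

/-- `linMul` adds one coefficient. [folklore] -/
theorem length_linMul (γ : ℤ) (L : List ℤ) : (linMul γ L).length = L.length + 1 := length_lmAux γ 0 L

/-- The Krawtchouk row has `p + q + 1` entries. [folklore] -/
theorem length_krRow (γ δ : ℤ) (p q : ℕ) : (krRow γ δ p q).length = p + q + 1 := by
  unfold krRow
  induction q with
  | zero =>
    simp only [Function.iterate_zero, id_eq, Nat.add_zero]
    induction p with
    | zero => rfl
    | succ p ih => rw [Function.iterate_succ_apply', length_linMul, ih]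
  | succ q ih => rw [Function.iterate_succ_apply', length_linMul, ih]; omega

/-- Homogeneous evaluation of one multiplication step. [folklore] -/
theorem hev_lmAux (γ u v p : ℤ) (t : List ℤ) :
    hev u v (lmAux γ p t) = γ * p * u ^ t.length + (u + γ * v) * hev u v t := by
  induction t generalizing p with
  | nil => simp [lmAux, hev]
  | cons a t ih =>
    simp only [lmAux, hev, length_lmAux, ih, List.length_cons]
    ring

/-- `hev (L · (1 + γ z)) = (u + γ v) · hev L`. [folklore] -/
theorem hev_linMul (γ u v : ℤ) (L : List ℤ) : hev u v (linMul γ L) = (u + γ * v) * hev u v L := by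
  simp [linMul, hev_lmAux]

/-- **The Krawtchouk expansion**: `Σ_s K_s u^{p+q−s} v^s = (u + γ v)^p (u + δ v)^q`. Column: proved (ours).
[cite: MacWilliamsSloane1977, Ch. 5 §7 eq. (54)] -/
theorem hev_krRow (γ δ u v : ℤ) (p q : ℕ) : hev u v (krRow γ δ p q) = (u + γ * v) ^ p * (u + δ * v) ^ q := by
  unfold krRow
  induction q with
  | zero =>
    simp only [Function.iterate_zero, id_eq, pow_zero, mul_one]
    induction p with
    | zero => simp [hev]
    | succ p ih => rw [Function.iterate_succ_apply', hev_linMul, ih, pow_succ]; ring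
  | succ q ih => rw [Function.iterate_succ_apply', hev_linMul, ih, pow_succ]; ring

/-- `hev` as an explicit sum over the coefficients. [folklore] -/
theorem hev_eq_sum (u v : ℤ) (L : List ℤ) :
    hev u v L = ∑ i ∈ range L.length, L.getD i 0 * u ^ (L.length - 1 - i) * v ^ i := by
  induction L with
  | nil => simp [hev]
  | cons a t ih =>
    rw [hev, ih, List.length_cons, Finset.sum_range_succ', Finset.mul_sum]
    simp only [List.getD_cons_zero, List.getD_cons_succ, pow_zero, mul_one]
    rw [show t.length + 1 - 1 - 0 = t.length by omega, add_comm]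
    congr 1
    refine Finset.sum_congr rfl fun i hi => ?_
    rw [show t.length + 1 - 1 - (i + 1) = t.length - 1 - i by omega, pow_succ]
    ring

/-! ### 2. Integer vectors and tables, streamed -/

/-- Non-truncating sum of two integer vectors. Column: definition (ours). [folklore] -/
def vadd : List ℤ → List ℤ → List ℤ
  | [], v => v
  | u, [] => u
  | a :: u, b :: v => (a + b) :: vadd u v

/-- Entries of `vadd`. [folklore] -/
theorem getD_vadd : ∀ (u v : List ℤ) (i : ℕ), (vadd u v).getD i 0 = u.getD i 0 + v.getD i 0
  | [], v, i => by simp [vadd]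
  | a :: u, [], i => by simp [vadd]
  | a :: u, b :: v, 0 => by simp [vadd]
  | a :: u, b :: v, i + 1 => by simp only [vadd, List.getD_cons_succ]; exact getD_vadd u v i

/-- Scalar multiple of an integer vector. Column: definition (ours). [folklore] -/
def vsmul (c : ℤ) (u : List ℤ) : List ℤ := u.map (c * ·)

/-- Entries of `vsmul`. [folklore] -/
theorem getD_vsmul (c : ℤ) : ∀ (u : List ℤ) (i : ℕ), (vsmul c u).getD i 0 = c * u.getD i 0
  | [], i => by simp [vsmul]
  | a :: u, 0 => by simp [vsmul]
  | a :: u, i + 1 => by simpa [vsmul] using getD_vsmul c u i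

/-- `Σ_i c_i • row_i` (streamed, no indexing). Column: definition (ours). [folklore] -/
def linComb : List ℤ → List (List ℤ) → List ℤ
  | c :: cs, r :: rs => vadd (vsmul c r) (linComb cs rs)
  | _, _ => []

/-- Entries of `linComb`. [folklore] -/
theorem getD_linComb : ∀ (cs : List ℤ) (rs : List (List ℤ)) (i : ℕ),
    (linComb cs rs).getD i 0 = (List.zipWith (fun c r => c * r.getD i 0) cs rs).sum
  | [], rs, i => by simp [linComb]
  | c :: cs, [], i => by simp [linComb]
  | c :: cs, r :: rs, i => by
    simp only [linComb, getD_vadd, getD_vsmul, getD_linComb cs rs i, List.zipWith_cons_cons, List.sum_cons]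

/-- Non-truncating sum of two integer tables. Column: definition (ours). [folklore] -/
def tadd : List (List ℤ) → List (List ℤ) → List (List ℤ)
  | [], V => V
  | U, [] => U
  | a :: U, b :: V => vadd a b :: tadd U V

/-- Entries of `tadd`. [folklore] -/
theorem get2_tadd : ∀ (U V : List (List ℤ)) (r s : ℕ), get2 (tadd U V) r s = get2 U r s + get2 V r s
  | [], V, r, s => by simp [tadd, get2]
  | a :: U, [], r, s => by simp [tadd, get2]
  | a :: U, b :: V, 0, s => by simp only [tadd, get2, List.getD_cons_zero]; exact getD_vadd a b s
  | a :: U, b :: V, r + 1, s => by simpa [tadd, get2] using get2_tadd U V r s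

/-- Scalar multiple of an integer table. Column: definition (ours). [folklore] -/
def tsmul (c : ℤ) (T : List (List ℤ)) : List (List ℤ) := T.map (vsmul c)

/-- Entries of `tsmul`. [folklore] -/
theorem get2_tsmul (c : ℤ) : ∀ (T : List (List ℤ)) (r s : ℕ), get2 (tsmul c T) r s = c * get2 T r s
  | [], r, s => by simp [tsmul, get2]
  | row :: T, 0, s => by simp only [tsmul, List.map_cons, get2, List.getD_cons_zero]; exact getD_vsmul c row s
  | row :: T, r + 1, s => by simpa [tsmul, get2] using get2_tsmul c T r s

/-- `Σ_i c_i • T_i` for tables. Column: definition (ours). [folklore] -/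
def linComb2 : List ℤ → List (List (List ℤ)) → List (List ℤ)
  | c :: cs, T :: Ts => tadd (tsmul c T) (linComb2 cs Ts)
  | _, _ => []

/-- Entries of `linComb2`. [folklore] -/
theorem get2_linComb2 : ∀ (cs : List ℤ) (Ts : List (List (List ℤ))) (r s : ℕ),
    get2 (linComb2 cs Ts) r s = (List.zipWith (fun c T => c * get2 T r s) cs Ts).sum
  | [], Ts, r, s => by simp [linComb2, get2]
  | c :: cs, [], r, s => by simp [linComb2, get2]
  | c :: cs, T :: Ts, r, s => by
    simp only [linComb2, get2_tadd, get2_tsmul, get2_linComb2 cs Ts r s, List.zipWith_cons_cons, List.sum_cons]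

/-! ### 3. List plumbing -/

/-- `zipWith` against an appended left list splits the right list by `take` / `drop`. [folklore] -/
theorem zipWith_append_left {α β : Type*} (g : α → ℤ → β) : ∀ (A B : List α) (mu : List ℤ),
    List.zipWith g (A ++ B) mu = List.zipWith g A (mu.take A.length) ++ List.zipWith g B (mu.drop A.length)
  | [], B, mu => by simp
  | a :: A, B, [] => by simp
  | a :: A, B, x :: mu => by simp [zipWith_append_left g A B mu]

/-- Split a flat list into consecutive chunks with the lengths of the given rows (last chunks possibly short).
Column: definition (ours). [folklore] -/
def chunkBy {α : Type*} : List (List α) → List ℤ → List (List ℤ)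
  | row :: rows, mu => mu.take row.length :: chunkBy rows (mu.drop row.length)
  | [], _ => []

/-- A `zipWith`-sum against a flattened list of rows is the sum of the row-wise `zipWith`-sums against the chunks.
[folklore] -/
theorem sum_zipWith_flatten {α : Type*} (g : α → ℤ → ℤ) : ∀ (rows : List (List α)) (mu : List ℤ),
    (List.zipWith g rows.flatten mu).sum =
      (List.zipWith (fun row ch => (List.zipWith g row ch).sum) rows (chunkBy rows mu)).sum
  | [], mu => by simp [chunkBy]
  | row :: rows, mu => by
    rw [List.flatten_cons, zipWith_append_left, List.sum_append, chunkBy, List.zipWith_cons_cons, List.sum_cons,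
      sum_zipWith_flatten g rows (mu.drop row.length)]

/-- `zipWith` through two `map`s. [folklore] -/
theorem zipWith_map_both {α β γ δ ε : Type*} (f : γ → δ → ε) (g : α → γ) (h : β → δ) :
    ∀ (l₁ : List α) (l₂ : List β), List.zipWith f (l₁.map g) (l₂.map h) = List.zipWith (fun a b => f (g a) (h b)) l₁ l₂
  | [], l₂ => by simp
  | a :: l₁, [] => by simp
  | a :: l₁, b :: l₂ => by simp [zipWith_map_both f g h l₁ l₂]

/-- `zipWith` through a `map` on the left. [folklore] -/
theorem zipWith_map_left {α β γ ε : Type*} (f : γ → β → ε) (g : α → γ) :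
    ∀ (l₁ : List α) (l₂ : List β), List.zipWith f (l₁.map g) l₂ = List.zipWith (fun a b => f (g a) b) l₁ l₂
  | [], l₂ => by simp
  | a :: l₁, [] => by simp
  | a :: l₁, b :: l₂ => by simp [zipWith_map_left f g l₁ l₂]

/-- `zipWith` through a `map` on the right. [folklore] -/
theorem zipWith_map_right {α β δ ε : Type*} (f : α → δ → ε) (h : β → δ) :
    ∀ (l₁ : List α) (l₂ : List β), List.zipWith f l₁ (l₂.map h) = List.zipWith (fun a b => f a (h b)) l₁ l₂
  | [], l₂ => by simp
  | a :: l₁, [] => by simp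
  | a :: l₁, b :: l₂ => by simp [zipWith_map_right f h l₁ l₂]

/-- `zipWith` of a mapped list against a `zipWith` over the same list. [folklore] -/
theorem zipWith_map_zipWith {α β γ δ ε : Type*} (F : γ → δ → ε) (f : α → γ) (G : α → β → δ) :
    ∀ (l : List α) (L : List β),
      List.zipWith F (l.map f) (List.zipWith G l L) = List.zipWith (fun a b => F (f a) (G a b)) l L
  | [], L => by simp
  | a :: l, [] => by simp
  | a :: l, b :: L => by simp [zipWith_map_zipWith F f G l L]

/-- Constants come out of `zipWith`-sums. [folklore] -/
theorem sum_zipWith_const_mul {α β : Type*} (cst : ℤ) (f : α → β → ℤ) :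
    ∀ (l₁ : List α) (l₂ : List β), (List.zipWith (fun a b => cst * f a b) l₁ l₂).sum = cst * (List.zipWith f l₁ l₂).sum
  | [], l₂ => by simp
  | a :: l₁, [] => by simp
  | a :: l₁, b :: l₂ => by simp [sum_zipWith_const_mul cst f l₁ l₂, mul_add]

/-- `zipWith`-sums are additive in the function. [folklore] -/
theorem sum_zipWith_add {α β : Type*} (f g : α → β → ℤ) :
    ∀ (l₁ : List α) (l₂ : List β),
      (List.zipWith (fun a b => f a b + g a b) l₁ l₂).sum = (List.zipWith f l₁ l₂).sum + (List.zipWith g l₁ l₂).sum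
  | [], l₂ => by simp
  | a :: l₁, [] => by simp
  | a :: l₁, b :: l₂ => by simp [sum_zipWith_add f g l₁ l₂]; ring

/-- `zipWith`-sums commute with finite sums. [folklore] -/
theorem sum_zipWith_finset {ι α β : Type*} (T : Finset ι) (F : ι → α → β → ℤ) (l₁ : List α) (l₂ : List β) :
    (List.zipWith (fun a b => ∑ t ∈ T, F t a b) l₁ l₂).sum = ∑ t ∈ T, (List.zipWith (F t) l₁ l₂).sum := by
  classical
  induction T using Finset.induction_on with
  | empty =>
    simp only [Finset.sum_empty]
    induction l₁ generalizing l₂ with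
    | nil => simp
    | cons a l₁ ih => cases l₂ <;> simp [ih]
  | insert t T ht ih =>
    simp only [Finset.sum_insert ht, ← ih, ← sum_zipWith_add]

/-- `zipWith` only depends on the function's values on members. [folklore] -/
theorem zipWith_congr_mem {α β γ : Type*} (f g : α → β → γ) :
    ∀ (l₁ : List α) (l₂ : List β), (∀ a ∈ l₁, ∀ b ∈ l₂, f a b = g a b) → List.zipWith f l₁ l₂ = List.zipWith g l₁ l₂
  | [], l₂, _ => by simp
  | a :: l₁, [], _ => by simp
  | a :: l₁, b :: l₂, h => by
    rw [List.zipWith_cons_cons, List.zipWith_cons_cons, h a (by simp) b (by simp),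
      zipWith_congr_mem f g l₁ l₂ fun a' ha' b' hb' => h a' (by simp [ha']) b' (by simp [hb'])]

/-- A `zipWith`-sum as an indexed sum when the left list is the shorter one. [folklore] -/
theorem sum_zipWith_eq_sum_range {β : Type*} (f : ℤ → β → ℤ) (dflt : β) :
    ∀ (K : List ℤ) (V : List β), K.length ≤ V.length →
      (List.zipWith f K V).sum = ∑ i ∈ range K.length, f (K.getD i 0) (V.getD i dflt)
  | [], V, _ => by simp
  | k :: K, [], h => by simp at h
  | k :: K, v :: V, h => by
    rw [List.zipWith_cons_cons, List.sum_cons, List.length_cons, Finset.sum_range_succ',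
      sum_zipWith_eq_sum_range f dflt K V (by simpa using h)]
    simp [add_comm]

/-! ### 4. The plain point table by moments -/

/-- The rows of the canonical y-grid: row `j` = the nodes `(1, j, l)`, `l ≤ w − j` (`gridY w` is their concatenation).
Column: definition (ours). [folklore] -/
def yrows (w : ℕ) : List (List (ℤ × ℤ × ℤ)) :=
  (List.range (w + 1)).map fun (j : ℕ) => (List.range (w + 1 - j)).map fun (l : ℕ) => ((1 : ℤ), (j : ℤ), (l : ℤ))

/-- Flattening singletons is mapping. [folklore] -/
theorem flatten_map_singleton {α β : Type*} (f : α → β) (l : List α) :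
    (l.map fun x => [f x]).flatten = l.map f := by
  induction l with
  | nil => rfl
  | cons a l ih => simp [ih]

/-- `gridY w` is the concatenation of `yrows w`. [folklore] -/
theorem gridY_eq_flatten (w : ℕ) : gridY w = (yrows w).flatten := by
  simp [gridY, yrows, List.map_map, Function.comp_def, List.flatMap_def, flatten_map_singleton]

/-- The power rows `[l^0, …, l^w]`, `l ≤ w` (running products, `powRow`). Column: definition (ours). [folklore] -/
def powRows (w : ℕ) : List (List ℤ) := (List.range (w + 1)).map fun (l : ℕ) => powRow (l : ℤ) w

/-- The column `[j^r]_{j ≤ w}` of the power rows. Column: definition (ours). [folklore] -/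
def jpows (w r : ℕ) : List ℤ := (powRows w).map fun row => row.getD r 0

/-- `jpows w r = [j^r]_{j ≤ w}`. [folklore] -/
theorem jpows_eq (w r : ℕ) (hr : r ≤ w) : jpows w r = (List.range (w + 1)).map fun (j : ℕ) => (j : ℤ) ^ r := by
  simp only [jpows, powRows, List.map_map]
  exact List.map_congr_left fun j _ => by simp only [Function.comp_apply, powRow_getD _ hr]

/-- The MOMENT table of one x-node: `M(j, s) = Σ_{l ≤ w−j} μ(j,l) · l^s` (row `j` = the chunk of the multiplier row
belonging to grid row `j`, combined with the power rows). Column: definition (ours). [folklore] -/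
def mtab (w : ℕ) (mu : List ℤ) : List (List ℤ) :=
  List.zipWith (fun (j : ℕ) ch => linComb ch ((powRows w).take (w + 1 - j))) (List.range (w + 1))
    (chunkBy (yrows w) mu)

/-- The inner table of one x-node by moments: `I(r, s) = Σ_j j^r · M(j, s)` — equal to the point sum
`Σ_{(j,l)} μ(j,l) · j^r l^s = Σ_j μ_j · yPart(y_j; r, s)` (`get2_itab`), in `O(w³)` products instead of `O(w⁴)`.
Column: definition (ours). [folklore] -/
def itab (w : ℕ) (mu : List ℤ) : List (List ℤ) :=
  let M := mtab w mu
  (List.range (w + 1)).map fun (r : ℕ) => linComb (jpows w r) M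

/-- The x-parts `xPart(x_i; a)` of the x-nodes. Column: definition (ours). [folklore] -/
def xcoefs (m a : ℕ) : List ℤ := (gridX m).map fun x => xPart m x a

/-- **The plain point table by moments**: `TP(a, r, s) = Σ_i xPart(x_i; a) · I_i(r, s)` — entry-wise equal to
`gridTab m w (gridX m) (gridY w) mus` inside the box (`ptab_eq_gridTabF`). Column: definition (ours).
[cite: CalderbankEtAl1998, §7 (ii) (printed p. 28)] -/
def ptab (m w : ℕ) (mus : List (List ℤ)) : List (List (List ℤ)) :=
  let its := mus.map (itab w)
  (List.range (m + 1)).map fun (a : ℕ) => linComb2 (xcoefs m a) its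

/-- A prefix of the power rows. [folklore] -/
theorem powRows_take (w j : ℕ) :
    (powRows w).take (w + 1 - j) = (List.range (w + 1 - j)).map fun (l : ℕ) => powRow (l : ℤ) w := by
  rw [powRows, ← List.map_take, List.take_range, Nat.min_eq_left (by omega)]

/-- **The one-node identity**: entry `(r, s)` of the inner table is the point sum `Σ_j μ_j · yPart(y_j; r, s)` over the
canonical y-grid (separability `yPart((1,j,l); r, s) = j^r · l^s` and the row/chunk decomposition of `gridY`).
Column: proved (ours). [folklore] -/
theorem get2_itab (w : ℕ) (mu : List ℤ) {r s : ℕ} (hr : r ≤ w) (hs : s ≤ w) :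
    get2 (itab w mu) r s = (List.zipWith (fun y t => t * yPart w y r s) (gridY w) mu).sum := by
  rw [get2, itab, getD_map_range w r _ [] hr, getD_linComb, jpows_eq w r hr, mtab, zipWith_map_zipWith,
    gridY_eq_flatten, sum_zipWith_flatten, yrows, zipWith_map_left]
  refine congrArg List.sum (zipWith_congr_mem _ _ _ _ fun j _ ch _ => ?_)
  rw [getD_linComb, powRows_take, zipWith_map_right, zipWith_map_left, List.zipWith_comm, ← sum_zipWith_const_mul]
  refine congrArg List.sum (zipWith_congr_mem _ _ _ _ fun t _ l _ => ?_)
  rw [powRow_getD _ hs, yPart]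
  simp only [one_pow, one_mul]
  ring

/-- **The plain point table by moments is the grid sum**: `TP(a, r, s) = gridSum … a r s` inside the box.
Column: proved (ours). [cite: CalderbankEtAl1998, §7 (ii) (printed p. 28)] -/
theorem get3_ptab (m w : ℕ) (mus : List (List ℤ)) {a r s : ℕ} (ha : a ≤ m) (hr : r ≤ w) (hs : s ≤ w) :
    get3 (ptab m w mus) a r s = gridSum m w (gridX m) (gridY w) mus a r s := by
  rw [show get3 (ptab m w mus) a r s = get2 ((ptab m w mus).getD a []) r s from rfl, ptab,
    getD_map_range m a _ [] ha, get2_linComb2, xcoefs, zipWith_map_both, gridSum]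
  exact congrArg List.sum (zipWith_congr_mem _ _ _ _ fun x _ mu _ => by rw [get2_itab w mu hr hs])


end Summit.Ventures.QEC.Census
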